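/-
COR-CM (cell pub-hodgecm2, stage 2 of the Hodge ladder) — count-neutral kernel combinatorics (seat prover-pub-hodgecm2-b23-g51-0, binder
prover b23, gen 51; lane SYLOW TRANSFER, claim HOME/INBOX.md l.23329).  Theorems only, in seat b09's intrinsic model (`CMF G c`, `gfaceSet`,
`pairSet`, `translates`, `hodgeSpan`, `Block`, `fibreTwo` — consumed BY NAME, nothing restated); no definition, no certificate, no `decide`,
no named fact, no geometry, no `sorry`.  `Interfaces.lean` (C1), every E term, B01 and `Transposition/*` are untouched.
HONEST FRAMING: `HC_CM` is NOT proved, here or anywhere in the tree; nothing here is a period or a headline.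
-/
import Summits.HodgeConjecture.CorCM.Census.SylowTransferComplement
import Summits.HodgeConjecture.CorCM.Census.SylowTransferCyclic
import Summits.HodgeConjecture.CorCM.Census.IndexTwoCyclicOrderEight

/-!
# Sylow transfer, III: every group of order `4·odd` — `μ(G, c) = φ₂(G, c)` for EVERY central involution

For `|G| = 4m` with `m` odd a Sylow `2`-subgroup `P ∋ c` has order `4` (**`card_sylow_eq_four`**).  DICHOTOMY: either `P` is cyclic — then
part II (`isLeast_card_gfaces_generate_fibreTwo_of_isCyclic_sylow`, Burnside transfer onto seat b09's CYCLIC-SYLOW LAW; `m = 1`: `G ≅ ℤ/4`,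
gen 38's cyclic law) — or `P ≅ ℤ/2 × ℤ/2` has exponent two (gen 50's `IndexTwoCyclic.forall_mul_self_of_card_eq_four`) and contains a second
involution `x ≠ c`, whose cyclic group `⟨x⟩` has index `2m ≡ 2 (mod 4)` and misses `c` — then part I (the coset sign,
`isLeast_card_gfaces_generate_fibreTwo_of_involution`, onto gen 40's COMPLEMENT LAW).  Hence
**`isLeast_card_gfaces_generate_fibreTwo_of_card_eq_four_mul_odd`**: for EVERY finite group of order `≡ 4 (mod 8)` and EVERY central involution
`c ≠ 1`, the least number of rank-four face relations whose base changes generate the integer Hodge lattice modulo pairs is EXACTLY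
`φ₂(G, c)` — no datum, no hypothesis on the group (**`…_of_card_mod_eight`**: hypothesis `|G| % 8 = 4` only).  With gen 40 F8
(`ComplementFaces.isLeast_card_gfaces_generate_of_odd_half`, `|G| ≡ 2 (mod 4)`): **every `(G, c)` with `8 ∤ |G|`**
(**`isLeast_card_gfaces_generate_fibreTwo_of_not_eight_dvd`**).
All [folklore] bookkeeping over [Pohlmann1968, Thm 1] in the reading of [Milne1999, Prop. 2.1].

## References
* [Pohlmann1968] H. Pohlmann, Algebraic cycles on abelian varieties of complex multiplication type, Ann. of Math. 88 (1968), Thm 1.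
* [Milne1999] J. S. Milne, Lefschetz motives and the Tate conjecture, Compositio Math. 117 (1999), Prop. 2.1, p. 54.
-/

namespace Summit.HodgeConjecture.CorCM.Census.SylowTransfer

open Finset
open Summit.HodgeConjecture.CorCM.Prior.AllgGroup.RfwfAllgGroup
open Summit.HodgeConjecture.CorCM.Census.BlockParity
open Summit.HodgeConjecture.CorCM.Census.Coinvariant

noncomputable section

variable {G : Type*} [Group G] [Fintype G] [DecidableEq G] (c : G)

/-! ## §1 The Sylow `2`-subgroup of a group of order `4·odd` -/

omit [DecidableEq G] in
/-- For `|G| = 4m` with `m` odd a Sylow `2`-subgroup has order `4`. [folklore] -/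
theorem card_sylow_eq_four (P : Sylow 2 G) {m : ℕ} (hG : Fintype.card G = 4 * m) (hm : Odd m) : Nat.card (P : Subgroup G) = 4 := by
  haveI : Fact (Nat.Prime 2) := ⟨Nat.prime_two⟩
  have hm0 : m ≠ 0 := fun h => by simp [h] at hm
  rw [Sylow.card_eq_multiplicity, Nat.card_eq_fintype_card, hG, Nat.factorization_mul (by norm_num) hm0, Finsupp.add_apply,
    Nat.factorization_eq_zero_of_not_dvd hm.not_two_dvd_nat, add_zero, show (4 : ℕ) = 2 ^ 2 by norm_num, Nat.factorization_pow,
    Finsupp.smul_apply, smul_eq_mul, Nat.prime_two.factorization_self, mul_one]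

omit [DecidableEq G] in
/-- For `|G| = 4m` with `m` odd a Sylow `2`-subgroup has index `m`. [folklore] -/
theorem index_sylow_eq (P : Sylow 2 G) {m : ℕ} (hG : Fintype.card G = 4 * m) (hm : Odd m) : (P : Subgroup G).index = m := by
  have h := (P : Subgroup G).card_mul_index
  rw [card_sylow_eq_four P hG hm, Nat.card_eq_fintype_card, hG] at h
  omega

omit [Fintype G] [DecidableEq G] in
/-- **DICHOTOMY in a non-cyclic subgroup**: a non-cyclic subgroup containing `c` contains an element outside `⟨c⟩`, i.e. some `y ≠ 1, c`. [folklore] -/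
theorem exists_mem_ne_of_not_isCyclic {P : Subgroup G} (hcP : c ∈ P) (hcyc : ¬ IsCyclic P) : ∃ y ∈ P, y ≠ 1 ∧ y ≠ c := by
  have hns : ¬ Function.Surjective (fun n : ℤ => (⟨c, hcP⟩ : P) ^ n) := fun hs => hcyc ⟨⟨_, hs⟩⟩
  obtain ⟨y, hy⟩ := not_forall.mp hns
  refine ⟨y, y.2, fun h1 => hy ⟨0, Subtype.ext ?_⟩, fun hc => hy ⟨1, Subtype.ext ?_⟩⟩
  · show (((⟨c, hcP⟩ : P) ^ (0 : ℤ) : P) : G) = y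
    rw [zpow_zero]; exact h1.symm
  · show (((⟨c, hcP⟩ : P) ^ (1 : ℤ) : P) : G) = y
    rw [zpow_one]; exact hc.symm

/-! ## §2 The law: every group of order `4·odd` -/

/-- **EVERY GROUP OF ORDER `4·odd`, EVERY CENTRAL INVOLUTION: `μ(G, c) = φ₂(G, c)`** — the least number of rank-four face relations whose base
changes generate the integer Hodge lattice modulo pairs is EXACTLY the coinvariant fibre dimension; no datum, no hypothesis on the group.
[folklore] -/
theorem isLeast_card_gfaces_generate_fibreTwo_of_card_eq_four_mul_odd {m : ℕ} (hG : Fintype.card G = 4 * m) (hm : Odd m)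
    (hc2 : c * c = 1) (hc1 : c ≠ 1) (hcen : ∀ x : G, x * c = c * x) :
    IsLeast {n : ℕ | ∃ S : Finset (CMF G c →₀ ℤ), (↑S ⊆ gfaceSet G c hc2) ∧ S.card = n ∧
      hodgeSpan c hc2 ≤ Submodule.span ℤ (pairSet c) ⊔ Submodule.span ℤ (translates c S)} (fibreTwo c hc2) := by
  haveI : Fact (Nat.Prime 2) := ⟨Nat.prime_two⟩
  obtain ⟨P⟩ := (inferInstance : Nonempty (Sylow 2 G))
  have hP4 := card_sylow_eq_four P hG hm
  have hcP : c ∈ (P : Subgroup G) := TypeStabiliser.mem_sylow_of_central c hc2 hcen P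
  have hG8 : Fintype.card G % 8 = 4 := by
    obtain ⟨j, rfl⟩ := hm
    omega
  by_cases hcyc : IsCyclic (P : Subgroup G)
  · by_cases hm1 : m = 1
    · -- `G = P ≅ ℤ/4`
      subst hm1
      have htop : (P : Subgroup G) = ⊤ := Subgroup.eq_top_of_card_eq _ (by rw [hP4, Nat.card_eq_fintype_card, hG])
      haveI : IsCyclic G := by
        haveI := hcyc
        refine isCyclic_of_surjective (P : Subgroup G).subtype fun g => ⟨⟨g, htop ▸ Subgroup.mem_top g⟩, rfl⟩
      exact IndexTwoCyclic.isLeast_card_gfaces_generate_fibreTwo_of_isCyclic hc2 hc1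
    · exact (isLeast_card_gfaces_generate_fibreTwo_of_isCyclic_sylow c P hcyc (by rw [hP4])
        (by rw [index_sylow_eq P hG hm]; exact hm1) hc2 hc1 hcen).1
  · -- `P ≅ ℤ/2 × ℤ/2`: a second involution
    obtain ⟨y, hyP, hy1, hyc⟩ := exists_mem_ne_of_not_isCyclic c hcP hcyc
    haveI : Fintype (P : Subgroup G) := Fintype.ofFinite _
    have hcard : Fintype.card (P : Subgroup G) = 4 := by rw [Fintype.card_eq_nat_card, hP4]
    have hyy : y * y = 1 := congrArg Subtype.val (IndexTwoCyclic.forall_mul_self_of_card_eq_four hcard hcyc ⟨y, hyP⟩)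
    exact isLeast_card_gfaces_generate_fibreTwo_of_involution c hc2 hc1 hcen hyy hy1 hyc hG8

/-- **`|G| ≡ 4 (mod 8)` form**: `μ(G, c) = φ₂(G, c)` for every finite group of order `≡ 4 (mod 8)` and every central involution `c ≠ 1`.
[folklore] -/
theorem isLeast_card_gfaces_generate_fibreTwo_of_card_mod_eight (hG : Fintype.card G % 8 = 4)
    (hc2 : c * c = 1) (hc1 : c ≠ 1) (hcen : ∀ x : G, x * c = c * x) :
    IsLeast {n : ℕ | ∃ S : Finset (CMF G c →₀ ℤ), (↑S ⊆ gfaceSet G c hc2) ∧ S.card = n ∧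
      hodgeSpan c hc2 ≤ Submodule.span ℤ (pairSet c) ⊔ Submodule.span ℤ (translates c S)} (fibreTwo c hc2) :=
  isLeast_card_gfaces_generate_fibreTwo_of_card_eq_four_mul_odd c (m := Fintype.card G / 4) (by omega)
    (Nat.odd_iff.mpr (by omega)) hc2 hc1 hcen

/-- **EVERY GROUP WHOSE ORDER IS NOT DIVISIBLE BY `8`, EVERY CENTRAL INVOLUTION: `μ(G, c) = φ₂(G, c)`** (`|G| ≡ 2 (mod 4)`: gen 40 F8,
`ComplementFaces.isLeast_card_gfaces_generate_of_odd_half` with seat b09's `Coinvariant.fibreTwo_add_one_eq_card_block_of_odd_half`;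
`|G| ≡ 4 (mod 8)`: this file). [folklore] -/
theorem isLeast_card_gfaces_generate_fibreTwo_of_not_eight_dvd (h8 : ¬ 8 ∣ Fintype.card G)
    (hc2 : c * c = 1) (hc1 : c ≠ 1) (hcen : ∀ x : G, x * c = c * x) :
    IsLeast {n : ℕ | ∃ S : Finset (CMF G c →₀ ℤ), (↑S ⊆ gfaceSet G c hc2) ∧ S.card = n ∧
      hodgeSpan c hc2 ≤ Submodule.span ℤ (pairSet c) ⊔ Submodule.span ℤ (translates c S)} (fibreTwo c hc2) := by
  have hord : orderOf c = 2 := orderOf_eq_prime (by rw [pow_two, hc2]) hc1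
  have h2 : 2 ∣ Fintype.card G := hord ▸ orderOf_dvd_card
  by_cases h4 : 4 ∣ Fintype.card G
  · exact isLeast_card_gfaces_generate_fibreTwo_of_card_mod_eight c (by omega) hc2 hc1 hcen
  · have hodd : Odd (Fintype.card G / 2) := Nat.odd_iff.mpr (by omega)
    have h := ComplementFaces.isLeast_card_gfaces_generate_of_odd_half c hc2 hc1 hcen hodd
    have hβ := fibreTwo_add_one_eq_card_block_of_odd_half c hc2 hc1 hcen hodd
    rwa [show Fintype.card (Block c) - 1 = fibreTwo c hc2 by omega] at h

end

end Summit.HodgeConjecture.CorCM.Census.SylowTransfer
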